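import Summits.Ventures.PercRepro.C026GoodDegreeForms
import Summits.Ventures.PercRepro.C026PFunTwoLiveLeaf
import Summits.Ventures.PercRepro.C026PFunBareDegreeTwo

/-!
# ROW C-041 `(G⅔)` on the skeletons without a Bad source (p6, gen 23)

Setting of `C026GoodDegreeBridge` / `C026GoodDegreeForms`: `(D,A)` sources, `Good_t`, `Bad`, `GG`, `SG`;
ROW C-041 `(G⅔)` is `2·n(D,A) ≤ 3·(#Good_a + #Good_b)`, equivalently `2·#Bad ≤ 4·#GG + #SG`
(`goodDegree_iff_bad_le_GG_SG`).  When NO `(D,A)` source is Bad the count is trivial, so `(G⅔)` holds on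
every class on which the lane has shown `Bad = ∅`; this file collects them as kernel statements of the row:

* `goodDegree_of_card_bad_eq_zero` — `#Bad = 0 ⟹ (G⅔)`;
* `good_of_probe_edge`, `card_bad_eq_zero_of_probe_edge`, `goodDegree_of_probe_edge` — **the probe adjacent to
  a terminal** (an edge with endpoints `c` and `a`): in every source that edge is red (a blue one would
  blue-join `c` and `a`) and it is a red walk from `c` to `a` avoiding the blue cluster of `b`, so every
  source is `Good_b`, `Bad = ∅`, `(G⅔)` holds — mine-3's §38 (h) (`Bad = 0` when `c` is adjacent to a
  terminal);
* `card_bad_eq_zero_of_leaf`, `goodDegree_of_leaf` (and the `b`-versions) — **a pendant terminal**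
  (`good_of_leaf` of `C026PFunTwoLiveLeaf`: every source is `Good_a`);
* `goodDegree_of_bare_degree_le_two` — **every bare vertex with at most two edges** (cycle and theta
  skeletons; `card_bad_eq_zero_of_bare_degree_le_two` of `C026PFunBareDegreeTwo`).

Each of these is a `(G⅔)` class statement with room (`#Bad = 0`); THEOREM L2 on them is already in the
tree by the `(E00)` bridges, so only the row's count is added here.
-/

namespace PercRepro

namespace MultiGraph

open Finset

variable {V E : Type*} {G : MultiGraph V E}

/-- **The probe adjacent to a terminal**: if some edge `e` has endpoints `c` and `a`, then in every
configuration with `c ≁_blue a`, `c ≁_blue b`, `a ≁_blue b` the edge is red and is a red walk from `c` to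
`a` avoiding the blue cluster of `b` — the configuration is `Good_b`. -/
theorem good_of_probe_edge {S : Config E} {a b c : V} {e : E}
    (he : (G.fst e = c ∧ G.snd e = a) ∨ (G.fst e = a ∧ G.snd e = c))
    (hca' : ¬ G.Conn Sᶜ c a) (hcb' : ¬ G.Conn Sᶜ c b) (hab' : ¬ G.Conn Sᶜ a b) :
    G.WalkAvoiding S (G.cluster Sᶜ b) c a := by
  -- the edge is red: a blue one would blue-join `c` and `a`
  have hred : S e = true := by
    by_contra h
    have h0 : S e = false := Bool.eq_false_iff.2 h
    have h1 : Sᶜ e = true := by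
      rw [compl_apply_not, h0]
      rfl
    have h2 := openAdj_of_open G e h1
    apply hca'
    apply Conn.of_openAdj
    rcases he with ⟨h3, h4⟩ | ⟨h3, h4⟩
    · rw [h3, h4] at h2
      exact h2
    · rw [h3, h4] at h2
      exact h2.symm
  have hadj : G.OpenAdj S c a := by
    have h2 := openAdj_of_open G e hred
    rcases he with ⟨h3, h4⟩ | ⟨h3, h4⟩
    · rw [h3, h4] at h2
      exact h2
    · rw [h3, h4] at h2
      exact h2.symm
  have hcW : c ∉ G.cluster Sᶜ b := fun h => hcb' ((G.mem_cluster).1 h).symm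
  have haW : a ∉ G.cluster Sᶜ b := fun h => hab' ((G.mem_cluster).1 h).symm
  exact ⟨hcW, Relation.ReflTransGen.single ⟨hadj, haW⟩⟩

section Count

variable [Fintype V] [DecidableEq V] [Fintype E] [DecidableEq E]

omit [Fintype V] [DecidableEq V] in
open Classical in
/-- **No Bad source ⟹ ROW C-041 `(G⅔)`**: `2·n(D,A) ≤ 3·(#Good_a + #Good_b)` when `#Bad = 0`. -/
theorem goodDegree_of_card_bad_eq_zero (a b c : V)
    (h0 : (univ.filter fun S : Config E => ((G.Conn S c a ∧ G.Conn S c b) ∧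
        (¬ G.Conn Sᶜ c a ∧ ¬ G.Conn Sᶜ c b ∧ ¬ G.Conn Sᶜ a b)) ∧
        ¬ (G.WalkAvoiding S (G.cluster Sᶜ a) c b ∨
          G.WalkAvoiding S (G.cluster Sᶜ b) c a)).card = 0) :
    2 * (univ.filter fun S : Config E => (G.Conn S c a ∧ G.Conn S c b) ∧
          (¬ G.Conn Sᶜ c a ∧ ¬ G.Conn Sᶜ c b ∧ ¬ G.Conn Sᶜ a b)).card ≤
        3 * ((univ.filter fun S : Config E => ((G.Conn S c a ∧ G.Conn S c b) ∧
            (¬ G.Conn Sᶜ c a ∧ ¬ G.Conn Sᶜ c b ∧ ¬ G.Conn Sᶜ a b)) ∧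
            G.WalkAvoiding S (G.cluster Sᶜ a) c b).card +
          (univ.filter fun S : Config E => ((G.Conn S c a ∧ G.Conn S c b) ∧
            (¬ G.Conn Sᶜ c a ∧ ¬ G.Conn Sᶜ c b ∧ ¬ G.Conn Sᶜ a b)) ∧
            G.WalkAvoiding S (G.cluster Sᶜ b) c a).card) := by
  rw [goodDegree_iff_bad_le_GG_SG, h0]
  exact Nat.zero_le _

omit [Fintype V] [DecidableEq V] in
open Classical in
/-- **`#Bad = 0` when the probe is adjacent to a terminal** (an edge with endpoints `c` and `a`). -/
theorem card_bad_eq_zero_of_probe_edge (a b c : V) (e : E)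
    (he : (G.fst e = c ∧ G.snd e = a) ∨ (G.fst e = a ∧ G.snd e = c)) :
    (univ.filter fun S : Config E => ((G.Conn S c a ∧ G.Conn S c b) ∧
        (¬ G.Conn Sᶜ c a ∧ ¬ G.Conn Sᶜ c b ∧ ¬ G.Conn Sᶜ a b)) ∧
        ¬ (G.WalkAvoiding S (G.cluster Sᶜ a) c b ∨
          G.WalkAvoiding S (G.cluster Sᶜ b) c a)).card = 0 := by
  rw [card_eq_zero, filter_eq_empty_iff]
  intro S _ h
  exact h.2 (Or.inr (good_of_probe_edge he h.1.2.1 h.1.2.2.1 h.1.2.2.2))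

omit [Fintype V] [DecidableEq V] in
open Classical in
/-- **ROW C-041 `(G⅔)` when the probe is adjacent to a terminal.** -/
theorem goodDegree_of_probe_edge (a b c : V) (e : E)
    (he : (G.fst e = c ∧ G.snd e = a) ∨ (G.fst e = a ∧ G.snd e = c)) :
    2 * (univ.filter fun S : Config E => (G.Conn S c a ∧ G.Conn S c b) ∧
          (¬ G.Conn Sᶜ c a ∧ ¬ G.Conn Sᶜ c b ∧ ¬ G.Conn Sᶜ a b)).card ≤
        3 * ((univ.filter fun S : Config E => ((G.Conn S c a ∧ G.Conn S c b) ∧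
            (¬ G.Conn Sᶜ c a ∧ ¬ G.Conn Sᶜ c b ∧ ¬ G.Conn Sᶜ a b)) ∧
            G.WalkAvoiding S (G.cluster Sᶜ a) c b).card +
          (univ.filter fun S : Config E => ((G.Conn S c a ∧ G.Conn S c b) ∧
            (¬ G.Conn Sᶜ c a ∧ ¬ G.Conn Sᶜ c b ∧ ¬ G.Conn Sᶜ a b)) ∧
            G.WalkAvoiding S (G.cluster Sᶜ b) c a).card) :=
  goodDegree_of_card_bad_eq_zero a b c (card_bad_eq_zero_of_probe_edge a b c e he)

omit [Fintype V] [DecidableEq V] in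
open Classical in
/-- **`#Bad = 0` when the terminal `a` is pendant** (at most one edge at `a`). -/
theorem card_bad_eq_zero_of_leaf (a b c : V) (e : E)
    (hleaf : ∀ f, G.fst f = a ∨ G.snd f = a → f = e) :
    (univ.filter fun S : Config E => ((G.Conn S c a ∧ G.Conn S c b) ∧
        (¬ G.Conn Sᶜ c a ∧ ¬ G.Conn Sᶜ c b ∧ ¬ G.Conn Sᶜ a b)) ∧
        ¬ (G.WalkAvoiding S (G.cluster Sᶜ a) c b ∨
          G.WalkAvoiding S (G.cluster Sᶜ b) c a)).card = 0 := by
  rw [card_eq_zero, filter_eq_empty_iff]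
  intro S _ h
  exact h.2 (Or.inl (good_of_leaf hleaf h.1.1.1 h.1.1.2 h.1.2.1 h.1.2.2.2))

omit [Fintype V] [DecidableEq V] in
open Classical in
/-- **ROW C-041 `(G⅔)` when the terminal `a` is pendant.** -/
theorem goodDegree_of_leaf (a b c : V) (e : E)
    (hleaf : ∀ f, G.fst f = a ∨ G.snd f = a → f = e) :
    2 * (univ.filter fun S : Config E => (G.Conn S c a ∧ G.Conn S c b) ∧
          (¬ G.Conn Sᶜ c a ∧ ¬ G.Conn Sᶜ c b ∧ ¬ G.Conn Sᶜ a b)).card ≤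
        3 * ((univ.filter fun S : Config E => ((G.Conn S c a ∧ G.Conn S c b) ∧
            (¬ G.Conn Sᶜ c a ∧ ¬ G.Conn Sᶜ c b ∧ ¬ G.Conn Sᶜ a b)) ∧
            G.WalkAvoiding S (G.cluster Sᶜ a) c b).card +
          (univ.filter fun S : Config E => ((G.Conn S c a ∧ G.Conn S c b) ∧
            (¬ G.Conn Sᶜ c a ∧ ¬ G.Conn Sᶜ c b ∧ ¬ G.Conn Sᶜ a b)) ∧
            G.WalkAvoiding S (G.cluster Sᶜ b) c a).card) :=
  goodDegree_of_card_bad_eq_zero a b c (card_bad_eq_zero_of_leaf a b c e hleaf)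

omit [Fintype V] [DecidableEq V] in
open Classical in
/-- **`#Bad = 0` when the terminal `b` is pendant.** -/
theorem card_bad_eq_zero_of_leaf' (a b c : V) (e : E)
    (hleaf : ∀ f, G.fst f = b ∨ G.snd f = b → f = e) :
    (univ.filter fun S : Config E => ((G.Conn S c a ∧ G.Conn S c b) ∧
        (¬ G.Conn Sᶜ c a ∧ ¬ G.Conn Sᶜ c b ∧ ¬ G.Conn Sᶜ a b)) ∧
        ¬ (G.WalkAvoiding S (G.cluster Sᶜ a) c b ∨
          G.WalkAvoiding S (G.cluster Sᶜ b) c a)).card = 0 := by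
  rw [card_eq_zero, filter_eq_empty_iff]
  intro S _ h
  exact h.2 (Or.inr (good_of_leaf hleaf h.1.1.2 h.1.1.1 h.1.2.2.1
    (fun h' => h.1.2.2.2 h'.symm)))

omit [Fintype V] [DecidableEq V] in
open Classical in
/-- **ROW C-041 `(G⅔)` when the terminal `b` is pendant.** -/
theorem goodDegree_of_leaf' (a b c : V) (e : E)
    (hleaf : ∀ f, G.fst f = b ∨ G.snd f = b → f = e) :
    2 * (univ.filter fun S : Config E => (G.Conn S c a ∧ G.Conn S c b) ∧
          (¬ G.Conn Sᶜ c a ∧ ¬ G.Conn Sᶜ c b ∧ ¬ G.Conn Sᶜ a b)).card ≤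
        3 * ((univ.filter fun S : Config E => ((G.Conn S c a ∧ G.Conn S c b) ∧
            (¬ G.Conn Sᶜ c a ∧ ¬ G.Conn Sᶜ c b ∧ ¬ G.Conn Sᶜ a b)) ∧
            G.WalkAvoiding S (G.cluster Sᶜ a) c b).card +
          (univ.filter fun S : Config E => ((G.Conn S c a ∧ G.Conn S c b) ∧
            (¬ G.Conn Sᶜ c a ∧ ¬ G.Conn Sᶜ c b ∧ ¬ G.Conn Sᶜ a b)) ∧
            G.WalkAvoiding S (G.cluster Sᶜ b) c a).card) :=
  goodDegree_of_card_bad_eq_zero a b c (card_bad_eq_zero_of_leaf' a b c e hleaf)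

omit [Fintype V] [DecidableEq V] in
open Classical in
/-- **ROW C-041 `(G⅔)` when every bare vertex has at most two edges** (cycle and theta skeletons). -/
theorem goodDegree_of_bare_degree_le_two (a b c : V)
    (hdeg : ∀ v, v ≠ a → v ≠ b → v ≠ c → ∀ e f g : E, G.EdgeAt e v → G.EdgeAt f v →
      G.EdgeAt g v → e = f ∨ e = g ∨ f = g) :
    2 * (univ.filter fun S : Config E => (G.Conn S c a ∧ G.Conn S c b) ∧
          (¬ G.Conn Sᶜ c a ∧ ¬ G.Conn Sᶜ c b ∧ ¬ G.Conn Sᶜ a b)).card ≤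
        3 * ((univ.filter fun S : Config E => ((G.Conn S c a ∧ G.Conn S c b) ∧
            (¬ G.Conn Sᶜ c a ∧ ¬ G.Conn Sᶜ c b ∧ ¬ G.Conn Sᶜ a b)) ∧
            G.WalkAvoiding S (G.cluster Sᶜ a) c b).card +
          (univ.filter fun S : Config E => ((G.Conn S c a ∧ G.Conn S c b) ∧
            (¬ G.Conn Sᶜ c a ∧ ¬ G.Conn Sᶜ c b ∧ ¬ G.Conn Sᶜ a b)) ∧
            G.WalkAvoiding S (G.cluster Sᶜ b) c a).card) :=
  goodDegree_of_card_bad_eq_zero a b c (card_bad_eq_zero_of_bare_degree_le_two hdeg)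

end Count

end MultiGraph

end PercRepro
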